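import Literature.Topology.FourManifolds.CircleBandCut
import Mathlib.LinearAlgebra.FreeModule.PID
import Mathlib.LinearAlgebra.Dimension.Free
import Mathlib.LinearAlgebra.Dimension.Constructions
import Mathlib.LinearAlgebra.Dimension.Localization
import HarnessLib

/-!
# The rank count for the complement of the cut

Topic `Literature/Topology/FourManifolds`. For a band trivialised over a circle-valued map
(`CircleBandData f`, `CircleBandCut.lean`; `L = {f = 1}` connected with `H₁(L; ℤ) ≅ ℤʳ`) on a
space `X` with `H₂(X; ℤ) = 0` in which the pieces `Y = {f ≠ 1}` and `N = {f ≠ -1}` carry no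
first homology of `X` (`H₁(Y) → H₁(X)` and `H₁(N) → H₁(X)` zero — for a knot complement: loops
missing the Seifert surface, or missing its antipodal level, have linking number `0` with `K`),
the Mayer–Vietoris sequence of `X = Y ∪ N`
`0 = H₂(X) → H₁(N₊) ⊕ H₁(N₋) → H₁(Y) ⊕ H₁(N) → H₁(X)` (the last map zero) gives
`H₁(Y) ⊕ H₁(N) ≅ H₁(L)²`, whence **`H₁(Y; ℤ)` is free of rank `r`**
(`CircleBandData.nonempty_basis_Y`) — the rank count behind "a Seifert matrix is square"
(Rolfsen (1976), §8.C; Lickorish (1997), Thm. 6.5: `H₁(S³ ∖ F) ≅ ℤ^{2g}`, there by Alexander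
duality, here by Mayer–Vietoris alone).

Everything is proved; no named fact is introduced.

## References

* D. Rolfsen, *Knots and Links*, Publish or Perish (1976), §8.C. [Rolfsen1976]
* A. Hatcher, *Algebraic Topology* (2002), §2.2 (Mayer–Vietoris). [HatcherAT2002]
-/

noncomputable section

-- as in the tree's singular-homology files: unification through the `ModuleCat`/biproduct API
set_option backward.isDefEq.respectTransparency false

open Set Function CategoryTheory Limits
open scoped Real Topology
open Literature.AlgebraicTopology.SingularHomology

universe u

namespace Literature.Topology.FourManifolds

namespace CircleMaps

namespace CyclicCover

variable {X : Type u} [TopologicalSpace X] {f : C(X, Circle)}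

/-! ### Homology transport along homeomorphisms and interval factors -/

section Transport

variable (R : Type) [CommRing R] (M : Type) [AddCommGroup M] [Module R M]

/-- A homeomorphism induces bijections on homology. [folklore] -/
theorem bijective_map_homeomorph {P Q : Type u} [TopologicalSpace P] [TopologicalSpace Q]
    (e : P ≃ₜ Q) (n : ℕ) : Bijective (singularHomology.map R M (e : C(P, Q)) n) :=
  ⟨fun a b hab => by
      simpa [map_homeomorph_symm_map] using congrArg (singularHomology.map R M (e.symm : C(Q, P)) n) hab,
    fun c => ⟨singularHomology.map R M (e.symm : C(Q, P)) n c, map_homeomorph_map_symm R M e n c⟩⟩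

variable (L : Type u) [TopologicalSpace L] {a b : ℝ}

/-- The projection `L × (a, b) → L`. [folklore] -/
def fstIoo : C(L × Ioo a b, L) := ⟨Prod.fst, continuous_fst⟩

/-- The slice `L → L × (a, b)`, `l ↦ (l, m)`. [folklore] -/
def sliceIoo {m : ℝ} (hm : m ∈ Ioo a b) : C(L, L × Ioo a b) := ⟨fun l => (l, ⟨m, hm⟩), by fun_prop⟩

/-- `slice ∘ fst ≃ id` (straight-line homotopy in the interval). [folklore] -/
def homotopySliceFst {m : ℝ} (hm : m ∈ Ioo a b) :
    ContinuousMap.Homotopy (ContinuousMap.id (L × Ioo a b)) ((sliceIoo L hm).comp (fstIoo L)) where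
  toFun q := (q.2.1, ⟨(1 - (q.1 : ℝ)) * q.2.2.1 + (q.1 : ℝ) * m, BandData.convexComb_mem_Ioo q.2.2.2 hm q.1⟩)
  continuous_toFun := by fun_prop
  map_zero_left p := by ext <;> simp
  map_one_left p := by ext <;> simp [sliceIoo, fstIoo]

/-- **The projection `L × (a, b) → L` induces bijections on homology** (a homotopy equivalence;
Hatcher Cor. 2.11). [cite: HatcherAT2002, Cor. 2.11] -/
theorem bijective_map_fstIoo (hab : a < b) (n : ℕ) : Bijective (singularHomology.map R M (fstIoo L (a := a) (b := b)) n) := by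
  obtain ⟨m, hm⟩ : (Ioo a b).Nonempty := nonempty_Ioo.2 hab
  have h1 : singularHomology.map R M (sliceIoo L hm) n ≫ singularHomology.map R M (fstIoo L) n = 𝟙 _ := by
    rw [← singularHomology.map_comp, show (fstIoo L).comp (sliceIoo L hm) = ContinuousMap.id L from rfl,
      singularHomology.map_id]
  have h2 : singularHomology.map R M (fstIoo L) n ≫ singularHomology.map R M (sliceIoo L hm) n = 𝟙 _ := by
    rw [← singularHomology.map_comp, ← singularHomology.map_eq_of_homotopic R M ⟨homotopySliceFst L hm⟩,
      singularHomology.map_id]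
  constructor
  · intro x y hxy
    have := congrArg (singularHomology.map R M (sliceIoo L hm) n) hxy
    rwa [← ModuleCat.comp_apply, ← ModuleCat.comp_apply, h2, ModuleCat.id_apply, ModuleCat.id_apply] at this
  · intro z
    exact ⟨singularHomology.map R M (sliceIoo L hm) n z, by rw [← ModuleCat.comp_apply, h1, ModuleCat.id_apply]⟩

/-- A bijective morphism of `ModuleCat` as a linear equivalence. [folklore] -/
def linearEquivOfBijective {A B : ModuleCat.{u} R} (g : A ⟶ B) (hg : Bijective g) : A ≃ₗ[R] B :=
  LinearEquiv.ofBijective g.hom hg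

end Transport

/-! ### The sides and the band have the homology of the cut -/

namespace CircleBandData

variable (B : CircleBandData f)
variable (R : Type) [CommRing R] (M : Type) [AddCommGroup M] [Module R M]

/-- **`Hₙ(N₊) ≃ Hₙ(L)`** (`N₊ ≅ L × (0, 1) ≃ L`). [folklore] -/
def plusEquiv (n : ℕ) : singularHomology R M ↥B.cutData.plus n ≃ₗ[R] singularHomology R M ↥{x | f x = Circle.exp 0} n :=
  (linearEquivOfBijective R _ (bijective_map_homeomorph R M B.homeoPlus n)).trans
    (linearEquivOfBijective R _ (bijective_map_fstIoo R M _ (zero_lt_one' ℝ) n))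

/-- **`Hₙ(N₋) ≃ Hₙ(L)`.** [folklore] -/
def minusEquiv (n : ℕ) : singularHomology R M ↥B.cutData.minus n ≃ₗ[R] singularHomology R M ↥{x | f x = Circle.exp 0} n :=
  (linearEquivOfBijective R _ (bijective_map_homeomorph R M B.homeoMinus n)).trans
    (linearEquivOfBijective R _ (bijective_map_fstIoo R M _ (show (-1 : ℝ) < 0 by norm_num) n))

/-- **`Hₙ(N) ≃ Hₙ(L)`.** [folklore] -/
def NEquiv (n : ℕ) : singularHomology R M ↥B.cutData.N n ≃ₗ[R] singularHomology R M ↥{x | f x = Circle.exp 0} n :=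
  (linearEquivOfBijective R _ (bijective_map_homeomorph R M B.homeoN n)).trans
    (linearEquivOfBijective R _ (bijective_map_fstIoo R M _ (show (-1 : ℝ) < 1 by norm_num) n))

end CircleBandData

/-! ### `Hₙ(Y ∩ N) ≅ Hₙ(N₊) × Hₙ(N₋)` -/

namespace CutData

variable (D : CutData f)
variable (R : Type) [CommRing R] (M : Type) [AddCommGroup M] [Module R M]

/-- `(p, q) ↦ incl₊ p + incl₋ q : Hₙ(N₊) × Hₙ(N₋) → Hₙ(Y ∩ N)`. [folklore] -/
def sideMap (n : ℕ) : (singularHomology R M ↥D.plus n × singularHomology R M ↥D.minus n) →ₗ[R]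
    singularHomology R M ↥(D.Y ∩ D.N) n :=
  (singularHomology.map R M (subsetInclusion D.plus_subset_inter) n).hom.coprod
    (singularHomology.map R M (subsetInclusion D.minus_subset_inter) n).hom

/-- `sideMap (p, q) = incl₊ p + incl₋ q`. [folklore] -/
theorem sideMap_apply (n : ℕ) (p : singularHomology R M ↥D.plus n) (q : singularHomology R M ↥D.minus n) :
    D.sideMap R M n (p, q) = singularHomology.map R M (subsetInclusion D.plus_subset_inter) n p +
      singularHomology.map R M (subsetInclusion D.minus_subset_inter) n q := rfl

/-- **`Hₙ(Y ∩ N) ≅ Hₙ(N₊) × Hₙ(N₋)`**: `sideMap` is bijective (additivity over the clopen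
partition `Y ∩ N = N₊ ⊔ N₋`, Hatcher Prop. 2.6). [cite: HatcherAT2002, Prop. 2.6] -/
theorem sideMap_bijective (n : ℕ) : Bijective (D.sideMap R M n) := by
  classical
  constructor
  · rw [injective_iff_map_eq_zero]
    rintro ⟨p, q⟩ hpq
    rw [sideMap_apply] at hpq
    -- read the two summands in the pieces `val ⁻¹' N±` of `↥(Y ∩ N)`
    set xt : singularHomology R M ↥(D.bpiece true) n :=
      singularHomology.map R M (D.plusHomeomorph.symm : C(↥D.plus, ↥(Subtype.val ⁻¹' D.plus : Set ↥(D.Y ∩ D.N)))) n p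
      with hxt
    set xf : singularHomology R M ↥(D.bpiece false) n :=
      singularHomology.map R M (D.minusHomeomorph.symm : C(↥D.minus, ↥(Subtype.val ⁻¹' D.minus : Set ↥(D.Y ∩ D.N)))) n q
      with hxf
    set x : ∀ b : Bool, singularHomology R M ↥(D.bpiece b) n := fun b => Bool.rec xf xt b with hx
    have hsum : ∑ b ∈ (Finset.univ : Finset Bool), singularHomology.map R M (subsetIncl (D.bpiece b)) n (x b) = 0 := by
      rw [Fintype.sum_bool]
      change singularHomology.map R M (subsetIncl (Subtype.val ⁻¹' D.plus)) n xt +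
        singularHomology.map R M (subsetIncl (Subtype.val ⁻¹' D.minus)) n xf = 0
      rw [hxt, hxf, ← ModuleCat.comp_apply, ← ModuleCat.comp_apply, ← singularHomology.map_comp,
        ← singularHomology.map_comp, subsetIncl_comp_plusHomeomorph_symm, subsetIncl_comp_minusHomeomorph_symm]
      exact hpq
    have ht := singularHomology.eq_zero_of_sum_map_subsetIncl_eq_zero (R := R) (M := M) D.isClopenPartition_bpiece n
      Finset.univ x hsum true (Finset.mem_univ _)
    have hf := singularHomology.eq_zero_of_sum_map_subsetIncl_eq_zero (R := R) (M := M) D.isClopenPartition_bpiece n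
      Finset.univ x hsum false (Finset.mem_univ _)
    change xt = 0 at ht
    change xf = 0 at hf
    rw [hxt] at ht
    rw [hxf] at hf
    have hp : p = 0 :=
      (bijective_map_homeomorph R M D.plusHomeomorph.symm n).1 (ht.trans (map_zero _).symm)
    have hq : q = 0 :=
      (bijective_map_homeomorph R M D.minusHomeomorph.symm n).1 (hf.trans (map_zero _).symm)
    rw [hp, hq]
    rfl
  · intro e
    obtain ⟨p, q, rfl⟩ := D.exists_eq_plus_add_minus R M n e
    exact ⟨(p, q), rfl⟩

/-- `Hₙ(N₊) × Hₙ(N₋) ≃ₗ Hₙ(Y ∩ N)`. [folklore] -/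
def sideEquiv (n : ℕ) : (singularHomology R M ↥D.plus n × singularHomology R M ↥D.minus n) ≃ₗ[R]
    singularHomology R M ↥(D.Y ∩ D.N) n :=
  LinearEquiv.ofBijective (D.sideMap R M n) (D.sideMap_bijective R M n)

/-! ### Mayer–Vietoris: `Hₙ(Y ∩ N) ≅ Hₙ(Y) × Hₙ(N)` -/

/-- The cover `X = Y ∪ N` has covering interiors. [folklore] -/
theorem interior_Y_union_interior_N : interior D.Y ∪ interior D.N = univ := by
  rw [D.isOpen_Y.interior_eq, D.isOpen_N.interior_eq, D.union_eq]

/-- `x ↦ (i_{Y*} x, i_{N*} x) : Hₙ(Y ∩ N) → Hₙ(Y) × Hₙ(N)`. [folklore] -/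
def toProd (n : ℕ) : singularHomology R M ↥(D.Y ∩ D.N) n →ₗ[R]
    (singularHomology R M ↥D.Y n × singularHomology R M ↥D.N n) :=
  (singularHomology.map R M (subsetInclusion (inter_subset_left : D.Y ∩ D.N ⊆ D.Y)) n).hom.prod
    (singularHomology.map R M (subsetInclusion (inter_subset_right : D.Y ∩ D.N ⊆ D.N)) n).hom

/-- The Mayer–Vietoris map `φ` read through `toProd`: `fst (φ x) = (toProd x).1`. [folklore] -/
theorem fst_φ_apply (n : ℕ) (x : singularHomology R M ↥(D.Y ∩ D.N) n) :
    (biprod.fst : singularHomology R M ↥D.Y n ⊞ singularHomology R M ↥D.N n ⟶ _)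
      (mayerVietoris.φ R M D.Y D.N n x) = (D.toProd R M n x).1 := by
  rw [← ModuleCat.comp_apply, mayerVietoris.φ, biprod.lift_fst]
  rfl

/-- `snd (φ x) = -(toProd x).2`. [folklore] -/
theorem snd_φ_apply (n : ℕ) (x : singularHomology R M ↥(D.Y ∩ D.N) n) :
    (biprod.snd : singularHomology R M ↥D.Y n ⊞ singularHomology R M ↥D.N n ⟶ _)
      (mayerVietoris.φ R M D.Y D.N n x) = -(D.toProd R M n x).2 := by
  rw [← ModuleCat.comp_apply, mayerVietoris.φ, biprod.lift_snd]
  rfl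

/-- An element of a biproduct in `ModuleCat` vanishes iff both its projections do. [folklore] -/
theorem biprod_eq_zero_iff {A C : ModuleCat.{u} R} (z : ↑(A ⊞ C)) :
    z = 0 ↔ (biprod.fst : A ⊞ C ⟶ A) z = 0 ∧ (biprod.snd : A ⊞ C ⟶ C) z = 0 := by
  constructor
  · rintro rfl
    exact ⟨map_zero _, map_zero _⟩
  · rintro ⟨h1, h2⟩
    have htot := ConcreteCategory.congr_hom (biprod.total : _ = 𝟙 (A ⊞ C)) z
    rw [ModuleCat.id_apply] at htot
    rw [← htot]
    change ((biprod.fst : A ⊞ C ⟶ A) ≫ (biprod.inl : A ⟶ A ⊞ C)) z +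
      ((biprod.snd : A ⊞ C ⟶ C) ≫ (biprod.inr : C ⟶ A ⊞ C)) z = 0
    rw [ModuleCat.comp_apply, ModuleCat.comp_apply, h1, h2, map_zero, map_zero, add_zero]

/-- **Mayer–Vietoris**: if `Hₙ₊₁(X) = 0` and `Hₙ(Y) → Hₙ(X)`, `Hₙ(N) → Hₙ(X)` vanish, then
`Hₙ(Y ∩ N) ≅ Hₙ(Y) × Hₙ(N)` by the two inclusions (Hatcher §2.2). [cite: HatcherAT2002, §2.2] -/
theorem toProd_bijective (n : ℕ) (h2 : IsZero (singularHomology R M X (n + 1)))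
    (hY : singularHomology.map R M (subsetIncl D.Y) n = 0)
    (hN : singularHomology.map R M (subsetIncl D.N) n = 0) : Bijective (D.toProd R M n) := by
  have hexc := relativeSingularHomology.isIso_map_of_interior_union_interior_holds R M X
  have hcov := D.interior_Y_union_interior_N
  constructor
  · -- `ker φ = im δ = 0`
    rw [injective_iff_map_eq_zero]
    intro x hx
    have hφ : mayerVietoris.φ R M D.Y D.N n x = 0 := by
      rw [biprod_eq_zero_iff, fst_φ_apply, snd_φ_apply, hx]
      exact ⟨rfl, neg_zero⟩
    have hexact := mayerVietoris.exact₃_holds (R := R) (M := M) D.Y D.N hexc hcov n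
    rw [ShortComplex.moduleCat_exact_iff] at hexact
    obtain ⟨y, hy⟩ := hexact x hφ
    rw [← hy]
    change (mayerVietoris.δ R M D.Y D.N hexc hcov n) y = 0
    have hy0 : y = 0 := by
      have := ConcreteCategory.congr_hom (h2.eq_of_src (𝟙 (singularHomology R M X (n + 1))) 0) y
      rw [ModuleCat.id_apply] at this
      exact this
    rw [hy0, map_zero]
  · -- `im φ = ker ψ = everything`
    rintro ⟨p, q⟩
    have hexact := mayerVietoris.exact₁_holds (R := R) (M := M) D.Y D.N hcov n
    rw [ShortComplex.moduleCat_exact_iff] at hexact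
    have hψ : mayerVietoris.ψ R M D.Y D.N n = 0 := by
      rw [mayerVietoris.ψ, hY, hN]
      exact biprod.hom_ext' _ _ (by simp) (by simp)
    set w : ↑(singularHomology R M ↥D.Y n ⊞ singularHomology R M ↥D.N n) :=
      (biprod.inl : _ ⟶ singularHomology R M ↥D.Y n ⊞ singularHomology R M ↥D.N n) p -
        (biprod.inr : _ ⟶ singularHomology R M ↥D.Y n ⊞ singularHomology R M ↥D.N n) q with hw
    obtain ⟨x, hx⟩ := hexact w (by
      show mayerVietoris.ψ R M D.Y D.N n w = 0
      rw [hψ]; rfl)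
    refine ⟨x, Prod.ext ?_ ?_⟩
    · rw [← fst_φ_apply]
      change (biprod.fst : singularHomology R M ↥D.Y n ⊞ singularHomology R M ↥D.N n ⟶ _)
        ((mayerVietoris.φ R M D.Y D.N n) x) = p
      rw [hx, hw, map_sub, ← ModuleCat.comp_apply, ← ModuleCat.comp_apply, biprod.inl_fst, biprod.inr_fst,
        ModuleCat.id_apply]
      exact sub_zero p
    · have h := D.snd_φ_apply R M n x
      change (biprod.snd : singularHomology R M ↥D.Y n ⊞ singularHomology R M ↥D.N n ⟶ _)
        ((mayerVietoris.φ R M D.Y D.N n) x) = _ at h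
      rw [hx, hw, map_sub, ← ModuleCat.comp_apply, ← ModuleCat.comp_apply, biprod.inl_snd, biprod.inr_snd,
        ModuleCat.id_apply] at h
      have : (0 : singularHomology R M ↥D.N n) - q = -(D.toProd R M n x).2 := h
      rw [zero_sub, neg_inj] at this
      exact this.symm

/-- `Hₙ(Y ∩ N) ≃ₗ Hₙ(Y) × Hₙ(N)` under the hypotheses of `toProd_bijective`. [folklore] -/
def prodEquiv (n : ℕ) (h2 : IsZero (singularHomology R M X (n + 1)))
    (hY : singularHomology.map R M (subsetIncl D.Y) n = 0)
    (hN : singularHomology.map R M (subsetIncl D.N) n = 0) :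
    singularHomology R M ↥(D.Y ∩ D.N) n ≃ₗ[R] (singularHomology R M ↥D.Y n × singularHomology R M ↥D.N n) :=
  LinearEquiv.ofBijective (D.toProd R M n) (D.toProd_bijective R M n h2 hY hN)

end CutData

/-! ### The rank count -/

namespace CutData

variable (D : CutData f) {r : ℕ}
variable (R : Type) [CommRing R] (M : Type) [AddCommGroup M] [Module R M]

/-- **A basis of `H₁(Y ∩ N)` from bases of the sides**: `incl₊ bP ⊔ incl₋ bM`. [folklore] -/
def interBasis (bP : Module.Basis (Fin r) R (singularHomology R M ↥D.plus 1))
    (bM : Module.Basis (Fin r) R (singularHomology R M ↥D.minus 1)) :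
    Module.Basis (Fin r ⊕ Fin r) R (singularHomology R M ↥(D.Y ∩ D.N) 1) := by
  classical
  refine Module.Basis.mk (v := fun i => Sum.elim
    (fun a => singularHomology.map R M (subsetInclusion D.plus_subset_inter) 1 (bP a))
    (fun a => singularHomology.map R M (subsetInclusion D.minus_subset_inter) 1 (bM a)) i) ?_ ?_
  · rw [Fintype.linearIndependent_iff]
    intro G hG
    rw [Fintype.sum_sum_type] at hG
    simp only [Sum.elim_inl, Sum.elim_inr] at hG
    have hpq : D.sideMap R M 1 (∑ a, G (Sum.inl a) • bP a, ∑ a, G (Sum.inr a) • bM a) = 0 := by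
      rw [sideMap_apply, map_sum, map_sum]
      simpa only [map_smul] using hG
    have h0 := (D.sideMap_bijective R M 1).1 (hpq.trans (map_zero _).symm)
    have hp : ∑ a, G (Sum.inl a) • bP a = 0 := congrArg Prod.fst h0
    have hq : ∑ a, G (Sum.inr a) • bM a = 0 := congrArg Prod.snd h0
    have hP := Fintype.linearIndependent_iff.1 bP.linearIndependent _ hp
    have hM := Fintype.linearIndependent_iff.1 bM.linearIndependent _ hq
    rintro (a | a)
    · exact hP a
    · exact hM a
  · rintro e -
    obtain ⟨p, q, rfl⟩ := D.exists_eq_plus_add_minus R M 1 e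
    refine Submodule.add_mem _ ?_ ?_
    · have hp : singularHomology.map R M (subsetInclusion D.plus_subset_inter) 1 p =
          ∑ a, bP.repr p a • singularHomology.map R M (subsetInclusion D.plus_subset_inter) 1 (bP a) := by
        conv_lhs => rw [← bP.sum_repr p]
        rw [map_sum]
        exact Finset.sum_congr rfl fun a _ => map_smul _ _ _
      rw [hp]
      exact Submodule.sum_mem _ fun a _ => Submodule.smul_mem _ _ (Submodule.subset_span ⟨Sum.inl a, rfl⟩)
    · have hq : singularHomology.map R M (subsetInclusion D.minus_subset_inter) 1 q =
          ∑ a, bM.repr q a • singularHomology.map R M (subsetInclusion D.minus_subset_inter) 1 (bM a) := by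
        conv_lhs => rw [← bM.sum_repr q]
        rw [map_sum]
        exact Finset.sum_congr rfl fun a _ => map_smul _ _ _
      rw [hq]
      exact Submodule.sum_mem _ fun a _ => Submodule.smul_mem _ _ (Submodule.subset_span ⟨Sum.inr a, rfl⟩)

/-- The push-forward `g = i_{Y*} : H₁(Y ∩ N) → H₁(Y)`. [folklore] -/
def toY : singularHomology R M ↥(D.Y ∩ D.N) 1 →ₗ[R] singularHomology R M ↥D.Y 1 :=
  (singularHomology.map R M (subsetInclusion (inter_subset_left : D.Y ∩ D.N ⊆ D.Y)) 1).hom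

/-- The push-forward `i_{N*} : H₁(Y ∩ N) → H₁(N)`. [folklore] -/
def toN : singularHomology R M ↥(D.Y ∩ D.N) 1 →ₗ[R] singularHomology R M ↥D.N 1 :=
  (singularHomology.map R M (subsetInclusion (inter_subset_right : D.Y ∩ D.N ⊆ D.N)) 1).hom

/-- `toProd x = (toY x, toN x)`. [folklore] -/
theorem toProd_apply (x : singularHomology R M ↥(D.Y ∩ D.N) 1) : D.toProd R M 1 x = (D.toY R M x, D.toN R M x) := rfl

section RankCount

variable (h2 : IsZero (singularHomology R M X 2))
  (hY : singularHomology.map R M (subsetIncl D.Y) 1 = 0)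
  (hN : singularHomology.map R M (subsetIncl D.N) 1 = 0)
include h2 hY hN

/-- `g = i_{Y*}` is onto. [folklore] -/
theorem toY_surjective : Surjective (D.toY R M) := fun y => by
  obtain ⟨x, hx⟩ := (D.toProd_bijective R M 1 h2 hY hN).2 (y, 0)
  exact ⟨x, by rw [toProd_apply] at hx; exact congrArg Prod.fst hx⟩

/-- `i_{N*}` restricted to `ker i_{Y*}` is bijective onto `H₁(N)`. [folklore] -/
theorem bijective_toN_comp_ker_subtype :
    Bijective ((D.toN R M).comp (LinearMap.ker (D.toY R M)).subtype) := by
  constructor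
  · rintro ⟨x, hx⟩ ⟨x', hx'⟩ h
    apply Subtype.ext
    apply (D.toProd_bijective R M 1 h2 hY hN).1
    rw [toProd_apply, toProd_apply]
    rw [LinearMap.mem_ker] at hx hx'
    change (D.toN R M) x = (D.toN R M) x' at h
    rw [hx, hx', h]
  · intro nn
    obtain ⟨x, hx⟩ := (D.toProd_bijective R M 1 h2 hY hN).2 (0, nn)
    rw [toProd_apply] at hx
    exact ⟨⟨x, congrArg Prod.fst hx⟩, congrArg Prod.snd hx⟩

/-- `H₁(Y)` is torsion free (it embeds in `H₁(Y ∩ N)` by `y ↦ toProd⁻¹ (y, 0)`). [folklore] -/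
theorem isTorsionFree_Y [Module.IsTorsionFree R (singularHomology R M ↥(D.Y ∩ D.N) 1)] :
    Module.IsTorsionFree R (singularHomology R M ↥D.Y 1) := by
  have hb := D.toProd_bijective R M 1 h2 hY hN
  choose sct hsct using fun y : singularHomology R M ↥D.Y 1 => hb.2 (y, 0)
  refine Function.Injective.moduleIsTorsionFree sct (fun y y' h => ?_) (fun c y => hb.1 ?_)
  · have := congrArg (D.toProd R M 1) h
    rw [hsct, hsct] at this
    exact congrArg Prod.fst this
  · rw [map_smul, hsct, hsct, Prod.smul_mk, smul_zero]

/-- **The rank count**: if the two sides `N₊`, `N₋` and the band `N` have first homology free of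
rank `r` (bases `bP`, `bM`, and `finrank H₁(N) = r`), `H₂(X; ℤ) = 0`, and `H₁(Y) → H₁(X)`,
`H₁(N) → H₁(X)` vanish, then `H₁(Y; ℤ)` is free of rank `r` (Rolfsen 1976, §8.C; Lickorish 1997,
Thm. 6.5, there via Alexander duality). [cite: Rolfsen1976, §8.C] -/
theorem nonempty_basis_Y_of [IsDomain R] [IsPrincipalIdealRing R]
    (bP : Module.Basis (Fin r) R (singularHomology R M ↥D.plus 1))
    (bM : Module.Basis (Fin r) R (singularHomology R M ↥D.minus 1))
    (hNr : Module.finrank R (singularHomology R M ↥D.N 1) = r) :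
    Nonempty (Module.Basis (Fin r) R (singularHomology R M ↥D.Y 1)) := by
  let bI := D.interBasis R M bP bM
  haveI : Module.Finite R (singularHomology R M ↥(D.Y ∩ D.N) 1) := Module.Finite.of_basis bI
  haveI : Module.Free R (singularHomology R M ↥(D.Y ∩ D.N) 1) := Module.Free.of_basis bI
  have hI : Module.finrank R (singularHomology R M ↥(D.Y ∩ D.N) 1) = r + r := by
    rw [Module.finrank_eq_card_basis bI, Fintype.card_sum, Fintype.card_fin]
  have hsurj := D.toY_surjective R M h2 hY hN
  haveI : Module.Finite R (singularHomology R M ↥D.Y 1) := Module.Finite.of_surjective (D.toY R M) hsurj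
  haveI : Module.IsTorsionFree R (singularHomology R M ↥D.Y 1) := D.isTorsionFree_Y R M h2 hY hN
  have hK : Module.finrank R (LinearMap.ker (D.toY R M)) = r := by
    rw [(LinearEquiv.ofBijective _ (D.bijective_toN_comp_ker_subtype R M h2 hY hN)).finrank_eq, hNr]
  have hrn := (LinearMap.ker (D.toY R M)).finrank_quotient_add_finrank
  rw [((D.toY R M).quotKerEquivOfSurjective hsurj).finrank_eq, hK, hI] at hrn
  have hYr : Module.finrank R (singularHomology R M ↥D.Y 1) = r := by omega
  exact ⟨Module.finBasisOfFinrankEq R (singularHomology R M ↥D.Y 1) hYr⟩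

end RankCount

end CutData

namespace CircleBandData

variable (B : CircleBandData f)

/-- **The rank count for a band trivialised over `f`** (Rolfsen 1976, §8.C; Lickorish 1997,
Thm. 6.5, there via Alexander duality): if `H₂(X; ℤ) = 0`, `H₁(Y) → H₁(X)` and `H₁(N) → H₁(X)`
vanish, and `H₁(L; ℤ)` (`L = {f = 1}`) has a `ℤ`-basis with `r` elements, then so does
`H₁(Y; ℤ)`, `Y = {f ≠ 1}` the complement of the cut. [cite: Rolfsen1976, §8.C] -/
theorem nonempty_basis_Y {r : ℕ} (bL : Module.Basis (Fin r) ℤ (singularHomology ℤ ℤ ↥{x | f x = Circle.exp 0} 1))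
    (h2 : IsZero (singularHomology ℤ ℤ X 2))
    (hY : singularHomology.map ℤ ℤ (subsetIncl B.cutData.Y) 1 = 0)
    (hN : singularHomology.map ℤ ℤ (subsetIncl B.cutData.N) 1 = 0) :
    Nonempty (Module.Basis (Fin r) ℤ (singularHomology ℤ ℤ ↥B.cutData.Y 1)) := by
  have hL : Module.finrank ℤ (singularHomology ℤ ℤ ↥{x | f x = Circle.exp 0} 1) = r := by
    rw [Module.finrank_eq_card_basis bL, Fintype.card_fin]
  have hNr : Module.finrank ℤ (singularHomology ℤ ℤ ↥B.cutData.N 1) = r := by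
    rw [(B.NEquiv ℤ ℤ 1).finrank_eq, hL]
  exact B.cutData.nonempty_basis_Y_of ℤ ℤ h2 hY hN (bL.map (B.plusEquiv ℤ ℤ 1).symm)
    (bL.map (B.minusEquiv ℤ ℤ 1).symm) hNr

/-- A companion: **`H₁(N; ℤ)` has a `ℤ`-basis with `r` elements** (`N ≅ L × (-1, 1)`). [folklore] -/
def basisN {r : ℕ} (bL : Module.Basis (Fin r) ℤ (singularHomology ℤ ℤ ↥{x | f x = Circle.exp 0} 1)) :
    Module.Basis (Fin r) ℤ (singularHomology ℤ ℤ ↥B.cutData.N 1) :=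
  bL.map (B.NEquiv ℤ ℤ 1).symm

end CircleBandData


end CyclicCover

end CircleMaps

end Literature.Topology.FourManifolds
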